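import Literature.Computability.Cryptography.GoldreichLevinDecoder
import Literature.Computability.Cryptography.YaoAmplification
import HarnessLib

/-!
# The Goldreich–Levin inverter: definition, coin layout and success probability

Crypto layer, part 3. The inverter `𝒜_GL` of the Goldreich–Levin theorem for hiding functions
(Goldreich 2001, Thm 2.5.6 with §2.5.2; Liu–Pass 2020, Appendix, Thm [GL89]) as a randomized
algorithm on bit strings: on `⟨1ⁿ, y⟩` (`y = g(x‖ρ)`) with coins

  `sgn ‖ mask_J ‖ β ‖ ω' ‖ v ‖ c_D ‖ seeds ‖ τ ‖ (unused)`
  (lengths `1, K, 1, K·n, K, κ, k·n, k`; `K = d⌊log₂ n⌋`, `k = (2e+1)(⌊log₂ n⌋+1)+1`,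
  `κ = |coins| mod K_b` the advice-carried coin count of `D`),

it outputs the string decoder's candidate `candStr n k (predStr D …) seeds τ`
(`GoldreichLevinDecoder.lean`), i.e. Rackoff's candidate for the predictor built from `D`
(`run_split`, `indicator_run_eq`). Main result of the file: the **success probability** —
at a level `n` where `D`'s gap is `δ` (with the right sign), for every `(x, ρ)`-average,
`hidingProb g 𝒜_GL S m n ≥ δ / (4·2^K·2^k)` (`hidingProb_ge`), by `GLPred.inverter_count` and
`GLEns.advantage_mul_eq`. The efficiency of `𝒜_GL` (`glInvRun_polyTime`, named fact) and the
final contradiction are in the sequel.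

## References

* O. Goldreich, *Foundations of Cryptography I*, CUP 2001, Thm 2.5.6, §2.5.2–2.5.3.
* Y. Liu, R. Pass, *On one-way functions and Kolmogorov complexity*, FOCS 2020
  (arXiv:2009.11514), Appendix, Thm [GL89].
* S. Arora, B. Barak, *Computational Complexity: A Modern Approach*, CUP 2009, Thm 9.12.
-/

namespace Literature.Computability.Cryptography

open Finset Matrix Filter _root_.Computability Complexity Complexity.Stockmeyer AffineStr GLEns GLDec Polynomial

namespace GLInv

/-! ### Parameters -/

/-- `K = d⌊log₂ n⌋`, the number of hard-core bits. [folklore] -/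
def Kof (d n : ℕ) : ℕ := d * Nat.log 2 n

/-- `k = (2e+1)(⌊log₂ n⌋+1) + 1`, the number of Rackoff seeds (`2^k − 1 ≥ 2n^{2e+1}`). [folklore] -/
def kof (e n : ℕ) : ℕ := (2 * e + 1) * (Nat.log 2 n + 1) + 1

/-- **Enough pairwise independent queries**: `2·n^{2e+1} ≤ 2^k − 1`. [folklore] -/
theorem two_mul_pow_le_two_pow_kof (e n : ℕ) : 2 * n ^ (2 * e + 1) ≤ 2 ^ kof e n - 1 := by
  have h1 : n + 1 ≤ 2 ^ (Nat.log 2 n + 1) := Nat.lt_pow_succ_log_self one_lt_two n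
  have h2 : (n + 1) ^ (2 * e + 1) ≤ (2 ^ (Nat.log 2 n + 1)) ^ (2 * e + 1) := Nat.pow_le_pow_left h1 _
  have h3 : n ^ (2 * e + 1) + 1 ≤ (n + 1) ^ (2 * e + 1) := by
    have := Nat.pow_le_pow_left (Nat.le_succ n) (2 * e)
    calc n ^ (2 * e + 1) + 1 = n ^ (2 * e) * n + 1 := by rw [pow_succ]
      _ ≤ (n + 1) ^ (2 * e) * n + (n + 1) ^ (2 * e) := Nat.add_le_add (Nat.mul_le_mul_right _ this) (Nat.one_le_pow _ _ (Nat.succ_pos n))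
      _ = (n + 1) ^ (2 * e + 1) := by rw [pow_succ]; ring
  have h4 : 2 ^ kof e n = 2 * (2 ^ (Nat.log 2 n + 1)) ^ (2 * e + 1) := by
    rw [kof, pow_succ, ← pow_mul, mul_comm (Nat.log 2 n + 1)]; ring
  rw [h4]
  omega

/-- **Polynomially many queries**: `2^k ≤ 2^{2e+2}·n^{2e+1}` for `n ≥ 1`. [folklore] -/
theorem two_pow_kof_le {n : ℕ} (hn : 1 ≤ n) (e : ℕ) : 2 ^ kof e n ≤ 2 ^ (2 * e + 2) * n ^ (2 * e + 1) := by
  have h1 : 2 ^ (Nat.log 2 n + 1) ≤ 2 * n := by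
    rw [pow_succ, mul_comm]; exact Nat.mul_le_mul_left 2 (Nat.pow_log_le_self 2 (by omega))
  have h2 := Nat.pow_le_pow_left h1 (2 * e + 1)
  have h4 : 2 ^ kof e n = 2 * (2 ^ (Nat.log 2 n + 1)) ^ (2 * e + 1) := by
    rw [kof, pow_succ, ← pow_mul, mul_comm (Nat.log 2 n + 1)]; ring
  rw [h4, show 2 ^ (2 * e + 2) * n ^ (2 * e + 1) = 2 * (2 * n) ^ (2 * e + 1) by ring]
  exact Nat.mul_le_mul_left 2 h2

/-- `2^K ≤ n^d` for `n ≥ 1`. [folklore] -/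
theorem two_pow_Kof_le {n : ℕ} (hn : 1 ≤ n) (d : ℕ) : 2 ^ Kof d n ≤ n ^ d := by
  rw [Kof, mul_comm, pow_mul]
  exact Nat.pow_le_pow_left (Nat.pow_log_le_self 2 (by omega)) d

section Alg

variable (D : RandAlg (List Bool) Bool) (qD : Polynomial ℕ) (d e : ℕ)

/-- `D`'s input length in the Goldreich–Levin game, from `n` and `|y|`: `2n + 2 + (|y| + Kn + K)`. [folklore] -/
def Lin (n ℓ : ℕ) : ℕ := 2 * n + 2 + (ℓ + Kof d n * n + Kof d n)

/-- Strict bound `K_b = q_D(L_in) + 1` on `D`'s coin count. [folklore] -/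
def Kb (n ℓ : ℕ) : ℕ := qD.eval (Lin d n ℓ) + 1

/-- **The run function of the Goldreich–Levin inverter `𝒜_GL`** on `⟨1ⁿ, y⟩` with coins `c`:
parse the coin fields (each padded/cut to its nominal length by `fitLen`; the coin count of `D`
is `|c| mod K_b`) and output the string decoder's candidate for the string predictor.
[cite: Goldreich2001, Thm. 2.5.6 (proof, Section 2.5.3)] -/
def run (inp c : List Bool) : List Bool :=
  let n := (boolUnpair inp).1.length
  let y := (boolUnpair inp).2
  let K := Kof d n
  let k := kof e n
  let κ := c.length % Kb qD d n y.length
  let c1 := c.drop 1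
  let c2 := c1.drop K
  let c3 := c2.drop 1
  let c4 := c3.drop (K * n)
  let c5 := c4.drop K
  let c6 := c5.drop κ
  let c7 := c6.drop (k * n)
  candStr n k (predStr D n K ((c.take 1).headD false) (CondParams.fitLen (c1.take K) K) ((c2.take 1).headD false)
      (CondParams.fitLen (c3.take (K * n)) (K * n)) (CondParams.fitLen (c4.take K) K) (CondParams.fitLen (c5.take κ) κ) y)
    (CondParams.fitLen (c6.take (k * n)) (k * n)) (CondParams.fitLen (c7.take k) k)

/-- `𝒜_GL` as a randomized algorithm with coin budget `cl`. [folklore] -/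
def alg (cl : ℕ → ℕ) : RandAlg (List Bool) (List Bool) where
  run := run D qD d e
  coinLen := cl

/-- **Efficiency of the Goldreich–Levin inverter** (named fact, D-0014): for a PPT `D`, the run
function of `𝒜_GL` — parsing, `n·(2^k − 1)` evaluations of the string predictor (each one masked
xor over the seeds, one embedding and one call of `D`) and `n` majority votes, `2^k = O(n^{2e+1})` —
is polynomial time on the pair presentation of (input, coins). To be discharged with the `FP`
toolkit (sequel file). [Goldreich 2001, Thm 2.5.6 (proof: "algorithm A runs in polynomial time");
Arora–Barak 2009, Thm 9.12 (proof)] [cite: Goldreich2001, Thm. 2.5.6 (proof, Section 2.5.3)] -/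
def glInvRun_polyTime : Prop :=
  ∀ (D : RandAlg (List Bool) Bool) (qD : Polynomial ℕ) (d e : ℕ), IsPPT D encodeBool →
    PolyTimeComputable (fun p : List Bool × List Bool => boolPair p.1 p.2) id (Function.uncurry (run D qD d e))

end Alg

/-! ### The run function on split coins -/

/-- `headD` of a one-bit vector's string is its head. [folklore] -/
theorem headD_toList_one (s : List.Vector Bool 1) : s.toList.headD false = s.head := by
  obtain ⟨l, hl⟩ := s
  match l, hl with
  | [b], _ => rfl

section Split

variable (D : RandAlg (List Bool) Bool) (qD : Polynomial ℕ) (d e : ℕ)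

/-- **`𝒜_GL` on split coins**: with the fields of their nominal lengths in front (and `κ` decoded
from the total coin count), the run is the string decoder on the string predictor. [folklore] -/
theorem run_split {n κ : ℕ} (y : List Bool) (s : List.Vector Bool 1) (mJ : List.Vector Bool (Kof d n)) (β : List.Vector Bool 1)
    (ω' : List.Vector Bool (Kof d n * n)) (v : List.Vector Bool (Kof d n)) (cD : List.Vector Bool κ)
    (S : List.Vector Bool (kof e n * n)) (τ : List.Vector Bool (kof e n)) (w : List Bool)
    (hκ : (1 + (Kof d n + (1 + (Kof d n * n + (Kof d n + (κ + (kof e n * n + (kof e n + w.length)))))))) % Kb qD d n y.length = κ) :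
    run D qD d e (boolPair (unaryEncodeNat n) y)
        (s.toList ++ (mJ.toList ++ (β.toList ++ (ω'.toList ++ (v.toList ++ (cD.toList ++ (S.toList ++ (τ.toList ++ w)))))))) =
      candStr n (kof e n) (predStr D n (Kof d n) s.head mJ.toList β.head ω'.toList v.toList cD.toList y) S.toList τ.toList := by
  have hn : (unaryEncodeNat n).length = n := unary_decode_encode_nat n
  have hlen : (s.toList ++ (mJ.toList ++ (β.toList ++ (ω'.toList ++ (v.toList ++ (cD.toList ++ (S.toList ++ (τ.toList ++ w)))))))).length =
      1 + (Kof d n + (1 + (Kof d n * n + (Kof d n + (κ + (kof e n * n + (kof e n + w.length))))))) := by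
    simp only [List.length_append, List.Vector.toList_length]
  simp only [run, boolUnpair_boolPair, hn, hlen, hκ]
  simp only [List.take_left' (List.Vector.toList_length _), List.drop_left' (List.Vector.toList_length _),
    CondParams.fitLen_of_length_eq (List.Vector.toList_length _), headD_toList_one]

end Split

/-! ### Re-indexing the coin fields by the objects of the math layer -/

/-- Masks of length `K` ≃ subsets of `[K]`. [folklore] -/
noncomputable def maskEquiv (K : ℕ) : List.Vector Bool K ≃ Finset (Fin K) :=
  Equiv.ofBijective (fun m => maskSet K m.toList) (by
    rw [Fintype.bijective_iff_injective_and_card]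
    refine ⟨fun m m' h => ?_, by rw [card_vector, Fintype.card_bool, Fintype.card_finset, Fintype.card_fin]⟩
    apply List.Vector.ext
    intro t
    have ht := Finset.ext_iff.1 h t
    simp only [maskSet, Finset.mem_filter, Finset.mem_univ, true_and] at ht
    rw [get_eq_getD, get_eq_getD]
    rcases Bool.eq_false_or_eq_true (m.toList.getD t false) with h1 | h1 <;>
      rcases Bool.eq_false_or_eq_true (m'.toList.getD t false) with h2 | h2 <;> simp_all)

/-- A sum over masks is a sum over subsets. [folklore] -/
theorem sum_vector_eq_sum_finset {M : Type*} [AddCommMonoid M] (K : ℕ) (F : Finset (Fin K) → M) :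
    ∑ m : List.Vector Bool K, F (maskSet K m.toList) = ∑ J : Finset (Fin K), F J :=
  Fintype.sum_equiv (maskEquiv K) _ _ fun _ => rfl

/-- One-bit vectors ≃ `𝔽₂` (by `bz ∘ head`). [folklore] -/
def bitEquiv : List.Vector Bool 1 ≃ ZMod 2 where
  toFun s := bz s.head
  invFun b := ⟨[decide (b = 1)], rfl⟩
  left_inv s := by
    obtain ⟨l, hl⟩ := s
    match l, hl with
    | [b], _ => cases b <;> rfl
  right_inv b := by fin_cases b <;> rfl

/-- A sum over one-bit vectors is a sum over `𝔽₂`. [folklore] -/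
theorem sum_vector_one_eq_sum_zmod {M : Type*} [AddCommMonoid M] (F : ZMod 2 → M) :
    ∑ s : List.Vector Bool 1, F (bz s.head) = ∑ b : ZMod 2, F b :=
  Fintype.sum_equiv bitEquiv _ _ fun _ => rfl

/-- A sum over strings of `k` blocks is a sum over block tuples. [folklore] -/
theorem sum_vector_eq_sum_blocks {M : Type*} [AddCommMonoid M] (n k : ℕ) (F : List Bool → M) :
    ∑ S : List.Vector Bool (k * n), F S.toList = ∑ sv : Fin k → BVec n, F (blocksStr sv) :=
  (Fintype.sum_equiv (blocksEquiv n k) (fun sv => F (blocksStr sv)) (fun S => F S.toList) fun _ => rfl).symm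

/-- **The coin fields ≃ the objects of the math layer** (masks ↦ subsets, bit ↦ `𝔽₂`, strings ↦
blocks / vectors; `D`'s coins unchanged), in the nesting of `GLPred.Coins × seeds × guesses`. [folklore] -/
noncomputable def fieldEquiv (n K k κ : ℕ) :
    (List.Vector Bool K × (List.Vector Bool 1 × (List.Vector Bool (K * n) × (List.Vector Bool K × List.Vector Bool κ)))) ×
        (List.Vector Bool (k * n) × List.Vector Bool k) ≃
      GLPred.Coins n K (List.Vector Bool κ) × (Fin k → BVec n) × (Fin k → ZMod 2) :=
  Equiv.prodCongr
    (Equiv.prodCongr (maskEquiv K) (Equiv.prodCongr bitEquiv (Equiv.prodCongr (blocksEquiv n K).symm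
      (Equiv.prodCongr (coinEquiv K) (Equiv.refl _)))))
    (Equiv.prodCongr (blocksEquiv n k).symm (coinEquiv k))

/-- Components of `fieldEquiv`. [folklore] -/
theorem fieldEquiv_apply {n K k κ : ℕ} (mJ : List.Vector Bool K) (β : List.Vector Bool 1) (ω' : List.Vector Bool (K * n))
    (v : List.Vector Bool K) (cD : List.Vector Bool κ) (S : List.Vector Bool (k * n)) (τ : List.Vector Bool k) :
    fieldEquiv n K k κ ((mJ, β, ω', v, cD), S, τ) =
      ((maskSet K mJ.toList, bz β.head, (blocksEquiv n K).symm ω', toZ v, cD), (blocksEquiv n k).symm S, toZ τ) := rfl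

/-- A string of blocks through `blocksEquiv.symm`. [folklore] -/
theorem toList_eq_blocksStr_symm {n k : ℕ} (S : List.Vector Bool (k * n)) : S.toList = blocksStr ((blocksEquiv n k).symm S) := by
  rw [← toList_blocksEquiv, Equiv.apply_symm_apply]

/-- The one-bit vector `[b]`. [folklore] -/
def sgnVec (b : Bool) : List.Vector Bool 1 := ⟨[b], rfl⟩

/-- `(sgnVec b).toList = [b]`. [folklore] -/
@[simp] theorem toList_sgnVec (b : Bool) : (sgnVec b).toList = [b] := rfl

/-- `(sgnVec b).head = b`. [folklore] -/
@[simp] theorem head_sgnVec (b : Bool) : (sgnVec b).head = b := rfl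

/-! ### The success event of `𝒜_GL` as the event of the math layer -/

section Success

variable (D : RandAlg (List Bool) Bool)

/-- **The sign-adjusted distinguisher as a function** of (blocks, bits, coins), for the input `y`:
`sgn ⊕ D(1ⁿ, y ‖ blocks σ ‖ bits u; c)`. [cite: Goldreich2001, Thm. 2.5.6 (proof, Section 2.5.3)] -/
def DfS (n K : ℕ) {κ : ℕ} (sgn : Bool) (y : List Bool) (σ : Fin K → BVec n) (u : BVec K) (c : List.Vector Bool κ) : Bool :=
  Bool.xor sgn (D.run (boolPair (unaryEncodeNat n) (y ++ blocksStr σ ++ encZ K u)) c.toList)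

variable {D}

/-- **The success event is Rackoff's candidate hitting the secret.** [folklore] -/
theorem indicator_iff {n K k κ : ℕ} (x : List.Vector Bool n) (y : List Bool) (sgn : Bool) (mJ : List.Vector Bool K)
    (β : List.Vector Bool 1) (ω'v : Fin K → BVec n) (vv : BVec K) (c : List.Vector Bool κ) (sv : Fin k → BVec n) (τv : BVec k) :
    candStr n k (predStr D n K sgn mJ.toList β.head (blocksStr ω'v) (encZ K vv) c.toList y) (blocksStr sv) (encZ k τv) = x.toList ↔
      glCandidate (fun r => GLPred.predB (DfS D n K sgn y) (maskSet K mJ.toList, bz β.head, ω'v, vv, c) r) k sv τv = toZ x := by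
  rw [candStr_eq]
  have hB : (fun r : BVec n => bz (predStr D n K sgn mJ.toList β.head (blocksStr ω'v) (encZ K vv) c.toList y (encZ n r))) =
      fun r => GLPred.predB (DfS D n K sgn y) (maskSet K mJ.toList, bz β.head, ω'v, vv, c) r :=
    funext fun r => bz_predStr rfl (List.Vector.toList_length _) rfl c rfl r
  rw [hB, ← encZ_toZ x]
  exact ⟨fun h => encZ_injective n h, fun h => by rw [h]⟩

variable (D) (qD : Polynomial ℕ) (d e : ℕ)

/-- **The number of successful coin strings** of `𝒜_GL` on `⟨1ⁿ, y⟩` (target `x`), over coins of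
length `C = 1 + K + 1 + Kn + K + κ + kn + k + W` decoding to `κ`, is at least `2^W` times the
success count of the math layer for either sign. [folklore] -/
theorem card_success_ge {n κ : ℕ} (x : List.Vector Bool n) (y : List Bool) (sgn : Bool) (W : ℕ)
    (hκ : (1 + (Kof d n + (1 + (Kof d n * n + (Kof d n + (κ + (kof e n * n + (kof e n + W)))))))) % Kb qD d n y.length = κ) :
    2 ^ W * (univ.filter fun t : GLPred.Coins n (Kof d n) (List.Vector Bool κ) × (Fin (kof e n) → BVec n) × (Fin (kof e n) → ZMod 2) =>
        glCandidate (fun r => GLPred.predB (DfS D n (Kof d n) sgn y) t.1 r) (kof e n) t.2.1 t.2.2 = toZ x).card ≤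
      (univ.filter fun coins : List.Vector Bool (1 + (Kof d n + (1 + (Kof d n * n + (Kof d n + (κ + (kof e n * n + (kof e n + W)))))))) =>
        run D qD d e (boolPair (unaryEncodeNat n) y) coins.toList = x.toList).card := by
  classical
  set K := Kof d n
  set k := kof e n
  set I : List Bool → ℕ := fun l => if run D qD d e (boolPair (unaryEncodeNat n) y) l = x.toList then 1 else 0 with hI
  rw [Finset.card_filter (fun coins : List.Vector Bool (1 + (K + (1 + (K * n + (K + (κ + (k * n + (k + W)))))))) =>
    run D qD d e (boolPair (unaryEncodeNat n) y) coins.toList = x.toList)]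
  change _ ≤ ∑ coins : List.Vector Bool (1 + (K + (1 + (K * n + (K + (κ + (k * n + (k + W)))))))), I coins.toList
  -- peel the sign bit and keep `sgn`
  have h1 := sum_vector_add (M := ℕ) 1 (K + (1 + (K * n + (K + (κ + (k * n + (k + W))))))) (fun u w => I (u ++ w))
  simp only [List.take_append_drop] at h1
  rw [h1]
  refine le_trans ?_ (Finset.single_le_sum (fun s _ => Nat.zero_le _) (Finset.mem_univ (sgnVec sgn)))
  rw [toList_sgnVec]
  -- peel the other fields
  have h2 := sum_vector_add (M := ℕ) K (1 + (K * n + (K + (κ + (k * n + (k + W)))))) (fun u w => I ([sgn] ++ (u ++ w)))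
  have h3 : ∀ mJ : List Bool, ∑ r : List.Vector Bool (1 + (K * n + (K + (κ + (k * n + (k + W)))))), I ([sgn] ++ (mJ ++ r.toList)) =
      ∑ β : List.Vector Bool 1, ∑ r : List.Vector Bool (K * n + (K + (κ + (k * n + (k + W))))), I ([sgn] ++ (mJ ++ (β.toList ++ r.toList))) :=
    fun mJ => by
      have h := sum_vector_add (M := ℕ) 1 (K * n + (K + (κ + (k * n + (k + W))))) (fun u w => I ([sgn] ++ (mJ ++ (u ++ w))))
      simpa only [List.take_append_drop] using h
  have h4 : ∀ p : List Bool, ∑ r : List.Vector Bool (K * n + (K + (κ + (k * n + (k + W))))), I (p ++ r.toList) =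
      ∑ ω' : List.Vector Bool (K * n), ∑ r : List.Vector Bool (K + (κ + (k * n + (k + W)))), I (p ++ (ω'.toList ++ r.toList)) :=
    fun p => by
      have h := sum_vector_add (M := ℕ) (K * n) (K + (κ + (k * n + (k + W)))) (fun u w => I (p ++ (u ++ w)))
      simpa only [List.take_append_drop] using h
  have h5 : ∀ p : List Bool, ∑ r : List.Vector Bool (K + (κ + (k * n + (k + W)))), I (p ++ r.toList) =
      ∑ v : List.Vector Bool K, ∑ r : List.Vector Bool (κ + (k * n + (k + W))), I (p ++ (v.toList ++ r.toList)) :=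
    fun p => by
      have h := sum_vector_add (M := ℕ) K (κ + (k * n + (k + W))) (fun u w => I (p ++ (u ++ w)))
      simpa only [List.take_append_drop] using h
  have h6 : ∀ p : List Bool, ∑ r : List.Vector Bool (κ + (k * n + (k + W))), I (p ++ r.toList) =
      ∑ cD : List.Vector Bool κ, ∑ r : List.Vector Bool (k * n + (k + W)), I (p ++ (cD.toList ++ r.toList)) :=
    fun p => by
      have h := sum_vector_add (M := ℕ) κ (k * n + (k + W)) (fun u w => I (p ++ (u ++ w)))
      simpa only [List.take_append_drop] using h
  have h7 : ∀ p : List Bool, ∑ r : List.Vector Bool (k * n + (k + W)), I (p ++ r.toList) =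
      ∑ S : List.Vector Bool (k * n), ∑ r : List.Vector Bool (k + W), I (p ++ (S.toList ++ r.toList)) :=
    fun p => by
      have h := sum_vector_add (M := ℕ) (k * n) (k + W) (fun u w => I (p ++ (u ++ w)))
      simpa only [List.take_append_drop] using h
  have h8 : ∀ p : List Bool, ∑ r : List.Vector Bool (k + W), I (p ++ r.toList) =
      ∑ τ : List.Vector Bool k, ∑ w : List.Vector Bool W, I (p ++ (τ.toList ++ w.toList)) :=
    fun p => by
      have h := sum_vector_add (M := ℕ) k W (fun u w => I (p ++ (u ++ w)))
      simpa only [List.take_append_drop] using h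
  simp only [List.take_append_drop] at h2
  rw [h2]
  simp only [h3]
  simp only [← List.append_assoc] at h4 h5 h6 h7 h8 ⊢
  simp only [h4, h5, h6, h7, h8]
  -- the innermost summand: the run on split coins, independent of `w`
  have hrun : ∀ (mJ : List.Vector Bool K) (β : List.Vector Bool 1) (ω' : List.Vector Bool (K * n)) (v : List.Vector Bool K)
      (cD : List.Vector Bool κ) (S : List.Vector Bool (k * n)) (τ : List.Vector Bool k) (w : List.Vector Bool W),
      I ([sgn] ++ mJ.toList ++ β.toList ++ ω'.toList ++ v.toList ++ cD.toList ++ S.toList ++ τ.toList ++ w.toList) =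
        if candStr n k (predStr D n K sgn mJ.toList β.head ω'.toList v.toList cD.toList y) S.toList τ.toList = x.toList then 1 else 0 := by
    intro mJ β ω' v cD S τ w
    simp only [hI, List.append_assoc]
    rw [← toList_sgnVec, run_split D qD d e y (sgnVec sgn) mJ β ω' v cD S τ w.toList (by rw [List.Vector.toList_length]; exact hκ)]
    rfl
  simp only [hrun, Finset.sum_const, Finset.card_univ, card_vector, Fintype.card_bool, smul_eq_mul]
  -- re-index the fields by the objects of the math layer
  rw [Finset.card_filter, Finset.mul_sum,
    show (∑ mJ : List.Vector Bool K, ∑ β : List.Vector Bool 1, ∑ ω' : List.Vector Bool (K * n), ∑ v : List.Vector Bool K,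
        ∑ cD : List.Vector Bool κ, ∑ S : List.Vector Bool (k * n), ∑ τ : List.Vector Bool k,
          2 ^ W * (if candStr n k (predStr D n K sgn mJ.toList β.head ω'.toList v.toList cD.toList y) S.toList τ.toList = x.toList then 1 else 0)) =
      ∑ q : (List.Vector Bool K × (List.Vector Bool 1 × (List.Vector Bool (K * n) × (List.Vector Bool K × List.Vector Bool κ)))) ×
          (List.Vector Bool (k * n) × List.Vector Bool k),
        2 ^ W * (if candStr n k (predStr D n K sgn q.1.1.toList q.1.2.1.head q.1.2.2.1.toList q.1.2.2.2.1.toList q.1.2.2.2.2.toList y)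
          q.2.1.toList q.2.2.toList = x.toList then 1 else 0) by simp only [Fintype.sum_prod_type]]
  refine (Fintype.sum_equiv (fieldEquiv n K k κ) _ _ fun q => ?_).ge
  obtain ⟨⟨mJ, β, ω', v, cD⟩, S, τ⟩ := q
  rw [fieldEquiv_apply]
  dsimp only
  rw [toList_eq_blocksStr_symm ω', toList_eq_blocksStr_symm S, ← encZ_toZ v, ← encZ_toZ τ]
  congr 1
  exact if_congr (indicator_iff x y sgn mJ β _ _ cD _ _) rfl rfl

/-! ### The gap hypothesis of the math layer, with the right sign -/

variable {qD d e}

/-- The `Df` of the math layer at level `n` for the input map `y = g(x‖ρ)` and sign `sgn`. [folklore] -/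
def DfX (g : List Bool → List Bool) (S : ∀ n : ℕ, Finset (List.Vector Bool n)) (n mm K κ : ℕ) (sgn : Bool)
    (x : ↥(S n)) (ρ : List.Vector Bool mm) (σ : Fin K → BVec n) (u : BVec K) (c : List.Vector Bool κ) : Bool :=
  DfS D n K sgn (g (x.1.toList ++ ρ.toList)) σ u c

/-- With `sgn = false` the function is the plain `GLEns.Df`. [folklore] -/
theorem DfX_false (g : List Bool → List Bool) (S : ∀ n : ℕ, Finset (List.Vector Bool n)) (n mm K κ : ℕ) :
    DfX D g S n mm K κ false = GLEns.Df D g S n mm K κ := by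
  funext x ρ σ u c
  simp [DfX, DfS, GLEns.Df, List.append_assoc]

/-- With `sgn = true` the function is the complement. [folklore] -/
theorem DfX_true (g : List Bool → List Bool) (S : ∀ n : ℕ, Finset (List.Vector Bool n)) (n mm K κ : ℕ)
    (x : ↥(S n)) (ρ : List.Vector Bool mm) (σ : Fin K → BVec n) (u : BVec K) (c : List.Vector Bool κ) :
    DfX D g S n mm K κ true x ρ σ u c = !(GLEns.Df D g S n mm K κ x ρ σ u c) := by
  simp [DfX, DfS, GLEns.Df, List.append_assoc]

/-- **The gap of the math layer for the sign-adjusted function equals `|Pr[real] − Pr[ideal]|`**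
(times the normaliser), choosing `sgn = [Pr real < Pr ideal]`. [cite: Goldreich2001, Thm. 2.5.6 (proof, Section 2.5.3)] -/
theorem gap_mul_eq (g : List Bool → List Bool) (S : ∀ n : ℕ, Finset (List.Vector Bool n)) {n mm K κ ℓ : ℕ}
    (hS : (S n).Nonempty) (hg : ∀ x ∈ S n, ∀ ρ : List.Vector Bool mm, (g (x.toList ++ ρ.toList)).length = ℓ)
    (hκ : D.coinLen (2 * n + 2 + (ℓ + K * n + K)) = κ) :
    let PrR := (acceptPMF D n ((condUniform (blockSeeds S (mm + K * n) n)).map (glReal g mm K n)) true).toReal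
    let PrI := (acceptPMF D n ((condUniform (blockSeeds S (mm + K * n + K) n)).map (glIdeal g mm n)) true).toReal
    |PrR - PrI| * ((S n).card * 2 ^ mm * 2 ^ (K * n) * 2 ^ K * 2 ^ κ) =
      2 ^ K * ((univ.filter fun q : ↥(S n) × List.Vector Bool mm × (Fin K → BVec n) × List.Vector Bool κ =>
          DfX D g S n mm K κ (decide (PrR < PrI)) q.1 q.2.1 q.2.2.1 (fun j => GLEns.sec S n q.1 ⬝ᵥ q.2.2.1 j) q.2.2.2 = true).card : ℝ) -
        ((univ.filter fun q : ↥(S n) × List.Vector Bool mm × (Fin K → BVec n) × BVec K × List.Vector Bool κ =>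
          DfX D g S n mm K κ (decide (PrR < PrI)) q.1 q.2.1 q.2.2.1 q.2.2.2.1 q.2.2.2.2 = true).card : ℝ) := by
  intro PrR PrI
  have hadv := GLEns.advantage_mul_eq (D := D) (g := g) (S := S) (n := n) (mm := mm) (K := K) (κ := κ) hS hg hκ
  change (PrR - PrI) * _ = _ at hadv
  by_cases hlt : PrR < PrI
  · -- complemented distinguisher
    simp only [hlt, decide_true]
    rw [abs_of_neg (sub_neg.2 hlt)]
    have hRe : ((univ.filter fun q : ↥(S n) × List.Vector Bool mm × (Fin K → BVec n) × List.Vector Bool κ =>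
          DfX D g S n mm K κ true q.1 q.2.1 q.2.2.1 (fun j => GLEns.sec S n q.1 ⬝ᵥ q.2.2.1 j) q.2.2.2 = true).card : ℝ) =
        (S n).card * 2 ^ mm * 2 ^ (K * n) * 2 ^ κ - GLEns.ReTot D g S n mm K κ := by
      rw [eq_sub_iff_add_eq, GLEns.ReTot]
      have h := Finset.card_filter_add_card_filter_not (s := (univ : Finset (↥(S n) × List.Vector Bool mm × (Fin K → BVec n) × List.Vector Bool κ)))
        (fun q => GLEns.Df D g S n mm K κ q.1 q.2.1 q.2.2.1 (fun j => GLEns.sec S n q.1 ⬝ᵥ q.2.2.1 j) q.2.2.2 = true)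
      rw [add_comm] at h
      have hc : Fintype.card (↥(S n) × List.Vector Bool mm × (Fin K → BVec n) × List.Vector Bool κ) =
          (S n).card * 2 ^ mm * 2 ^ (K * n) * 2 ^ κ := by
        simp only [Fintype.card_prod, Fintype.card_coe, card_vector, Fintype.card_bool, Fintype.card_fun, Fintype.card_fin]
        simp [ZMod.card, ← pow_mul, mul_comm K n]; ring
      rw [Finset.card_univ, hc] at h
      have h' : ((univ.filter fun q : ↥(S n) × List.Vector Bool mm × (Fin K → BVec n) × List.Vector Bool κ =>
            DfX D g S n mm K κ true q.1 q.2.1 q.2.2.1 (fun j => GLEns.sec S n q.1 ⬝ᵥ q.2.2.1 j) q.2.2.2 = true).card) =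
          (univ.filter fun q : ↥(S n) × List.Vector Bool mm × (Fin K → BVec n) × List.Vector Bool κ =>
            ¬ (GLEns.Df D g S n mm K κ q.1 q.2.1 q.2.2.1 (fun j => GLEns.sec S n q.1 ⬝ᵥ q.2.2.1 j) q.2.2.2 = true)).card := by
        congr 1; refine Finset.filter_congr fun q _ => ?_; rw [DfX_true]; simp
      rw [h']
      exact_mod_cast h
    have hId : ((univ.filter fun q : ↥(S n) × List.Vector Bool mm × (Fin K → BVec n) × BVec K × List.Vector Bool κ =>
          DfX D g S n mm K κ true q.1 q.2.1 q.2.2.1 q.2.2.2.1 q.2.2.2.2 = true).card : ℝ) =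
        (S n).card * 2 ^ mm * 2 ^ (K * n) * 2 ^ K * 2 ^ κ - GLEns.IdTot D g S n mm K κ := by
      rw [eq_sub_iff_add_eq, GLEns.IdTot]
      have h := Finset.card_filter_add_card_filter_not (s := (univ : Finset (↥(S n) × List.Vector Bool mm × (Fin K → BVec n) × BVec K × List.Vector Bool κ)))
        (fun q => GLEns.Df D g S n mm K κ q.1 q.2.1 q.2.2.1 q.2.2.2.1 q.2.2.2.2 = true)
      rw [add_comm] at h
      have hc : Fintype.card (↥(S n) × List.Vector Bool mm × (Fin K → BVec n) × BVec K × List.Vector Bool κ) =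
          (S n).card * 2 ^ mm * 2 ^ (K * n) * 2 ^ K * 2 ^ κ := by
        simp only [Fintype.card_prod, Fintype.card_coe, card_vector, Fintype.card_bool, Fintype.card_fun, Fintype.card_fin]
        simp [ZMod.card, ← pow_mul, mul_comm K n]; ring
      rw [Finset.card_univ, hc] at h
      have h' : ((univ.filter fun q : ↥(S n) × List.Vector Bool mm × (Fin K → BVec n) × BVec K × List.Vector Bool κ =>
            DfX D g S n mm K κ true q.1 q.2.1 q.2.2.1 q.2.2.2.1 q.2.2.2.2 = true).card) =
          (univ.filter fun q : ↥(S n) × List.Vector Bool mm × (Fin K → BVec n) × BVec K × List.Vector Bool κ =>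
            ¬ (GLEns.Df D g S n mm K κ q.1 q.2.1 q.2.2.1 q.2.2.2.1 q.2.2.2.2 = true)).card := by
        congr 1; refine Finset.filter_congr fun q _ => ?_; rw [DfX_true]; simp
      rw [h']
      exact_mod_cast h
    rw [hRe, hId]
    linarith [hadv]
  · simp only [hlt, decide_false]
    rw [abs_of_nonneg (sub_nonneg.2 (not_lt.1 hlt)), DfX_false]
    exact hadv

/-! ### The success probability of `𝒜_GL` -/

/-- The per-input success count of the math layer, summed over the inputs, is the count of
`GLPred.inverter_count`. [folklore] -/
theorem sum_succ_eq (g : List Bool → List Bool) (S : ∀ n : ℕ, Finset (List.Vector Bool n)) (n mm K k κ : ℕ) (sgn : Bool) :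
    (∑ x ∈ S n, ∑ ρ : List.Vector Bool mm,
      ((univ.filter fun t : GLPred.Coins n K (List.Vector Bool κ) × (Fin k → BVec n) × (Fin k → ZMod 2) =>
        glCandidate (fun r => GLPred.predB (DfS D n K sgn (g (x.toList ++ ρ.toList))) t.1 r) k t.2.1 t.2.2 = toZ x).card : ℝ)) =
      ((univ.filter fun t : (↥(S n) × List.Vector Bool mm × GLPred.Coins n K (List.Vector Bool κ)) × (Fin k → BVec n) × (Fin k → ZMod 2) =>
        glCandidate (fun r => GLPred.predB (DfX D g S n mm K κ sgn t.1.1 t.1.2.1) t.1.2.2 r) k t.2.1 t.2.2 = GLEns.sec S n t.1.1).card : ℝ) := by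
  classical
  rw [Finset.natCast_card_filter, Fintype.sum_prod_type, Fintype.sum_prod_type, ← Finset.sum_coe_sort (S n)]
  refine Finset.sum_congr rfl fun x _ => ?_
  rw [Fintype.sum_prod_type]
  refine Finset.sum_congr rfl fun ρ _ => ?_
  rw [Finset.natCast_card_filter, Fintype.sum_prod_type]
  rfl

variable (qD d e)

/-- **The success probability of the Goldreich–Levin inverter.** At a level `n` with `S_n ≠ ∅`,
`g` of output length `ℓ` on the seeds, `κ = D.coinLen` at `D`'s input length, a coin budget
`1 + K + 1 + Kn + K + κ + kn + k + W ≡ κ (mod K_b)` on the inputs `⟨1ⁿ, y⟩`, and a gap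
`δ ≤ |Pr[D real] − Pr[D ideal]|` with `n ≤ 2(δ/2^{K+1})²(2^k − 1)`:
`hidingProb g 𝒜_GL S m n ≥ δ / (4·2^K·2^k)`. [cite: Goldreich2001, Thm. 2.5.6 (proof, Section 2.5.3)] -/
theorem hidingProb_ge (g : List Bool → List Bool) (S : ∀ n : ℕ, Finset (List.Vector Bool n)) (m : ℕ → ℕ)
    {n ℓ κ W : ℕ} (cl : ℕ → ℕ) {δ : ℝ}
    (hS : (S n).Nonempty) (hg : ∀ x ∈ S n, ∀ ρ : List.Vector Bool (m n), (g (x.toList ++ ρ.toList)).length = ℓ)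
    (hκ : D.coinLen (Lin d n ℓ) = κ)
    (hC : (1 + (Kof d n + (1 + (Kof d n * n + (Kof d n + (κ + (kof e n * n + (kof e n + W)))))))) % Kb qD d n ℓ = κ)
    (hcl : cl (2 * n + 2 + ℓ) = 1 + (Kof d n + (1 + (Kof d n * n + (Kof d n + (κ + (kof e n * n + (kof e n + W))))))))
    (hk : 0 < kof e n) (hδ : 0 < δ)
    (hδle : δ ≤ distAdvantage D (glRealEns g S m d) (glIdealEns g S m d) n)
    (hm : (n : ℝ) ≤ 2 * (δ / 2 ^ Kof d n / 2) ^ 2 * (2 ^ kof e n - 1 : ℕ)) :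
    δ / (4 * 2 ^ Kof d n * 2 ^ kof e n) ≤ hidingProb g (alg D qD d e cl) S m n := by
  classical
  set K := Kof d n with hKdef
  set k := kof e n with hkdef
  set C := 1 + (K + (1 + (K * n + (K + (κ + (k * n + (k + W))))))) with hCdef
  set PrR := (acceptPMF D n ((condUniform (blockSeeds S (m n + K * n) n)).map (glReal g (m n) K n)) true).toReal with hPrR
  set PrI := (acceptPMF D n ((condUniform (blockSeeds S (m n + K * n + K) n)).map (glIdeal g (m n) n)) true).toReal with hPrI
  set sgn : Bool := decide (PrR < PrI) with hsgn
  have hadv_eq : distAdvantage D (glRealEns g S m d) (glIdealEns g S m d) n = |PrR - PrI| := rfl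
  -- Step 1: each input's success probability
  have hS0 : (0 : ℝ) < (S n).card := by exact_mod_cast hS.card_pos
  have hstep : ∀ x ∈ S n, ∀ ρ : List.Vector Bool (m n),
      (2 : ℝ) ^ W / 2 ^ C * ((univ.filter fun t : GLPred.Coins n K (List.Vector Bool κ) × (Fin k → BVec n) × (Fin k → ZMod 2) =>
          glCandidate (fun r => GLPred.predB (DfS D n K sgn (g (x.toList ++ ρ.toList))) t.1 r) k t.2.1 t.2.2 = toZ x).card : ℝ) ≤
        (alg D qD d e cl).pr id (boolPair (unaryEncodeNat n) (g (x.toList ++ ρ.toList))) {z | z = x.toList} := by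
    intro x hx ρ
    have hlen : (alg D qD d e cl).coinLen (id (boolPair (unaryEncodeNat n) (g (x.toList ++ ρ.toList)))).length = C := by
      show cl (boolPair (unaryEncodeNat n) (g (x.toList ++ ρ.toList))).length = C
      rw [length_boolPair, show (unaryEncodeNat n).length = n from unary_decode_encode_nat n, hg x hx ρ, hcl]
    rw [(alg D qD d e cl).pr_eq_card_filter_div id _ {z | z = x.toList} hlen, div_mul_eq_mul_div, div_le_div_iff_of_pos_right (by positivity)]
    have h := card_success_ge D qD d e x (g (x.toList ++ ρ.toList)) sgn W (by rw [hg x hx ρ]; exact hC)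
    have h' : ((2 ^ W * (univ.filter fun t : GLPred.Coins n K (List.Vector Bool κ) × (Fin k → BVec n) × (Fin k → ZMod 2) =>
        glCandidate (fun r => GLPred.predB (DfS D n K sgn (g (x.toList ++ ρ.toList))) t.1 r) k t.2.1 t.2.2 = toZ x).card : ℕ) : ℝ) ≤
        ((univ.filter fun coins : List.Vector Bool C =>
          run D qD d e (boolPair (unaryEncodeNat n) (g (x.toList ++ ρ.toList))) coins.toList = x.toList).card : ℝ) := by
      exact_mod_cast h
    push_cast at h'
    refine h'.trans (le_of_eq ?_)
    congr 2
  -- Step 2: sum over the inputs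
  have hsum : (2 : ℝ) ^ W / 2 ^ C *
      ((univ.filter fun t : (↥(S n) × List.Vector Bool (m n) × GLPred.Coins n K (List.Vector Bool κ)) × (Fin k → BVec n) × (Fin k → ZMod 2) =>
        glCandidate (fun r => GLPred.predB (DfX D g S n (m n) K κ sgn t.1.1 t.1.2.1) t.1.2.2 r) k t.2.1 t.2.2 = GLEns.sec S n t.1.1).card : ℝ) ≤
      ∑ x ∈ S n, ∑ ρ : List.Vector Bool (m n), (alg D qD d e cl).pr id (boolPair (unaryEncodeNat n) (g (x.toList ++ ρ.toList))) {z | z = x.toList} := by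
    rw [← sum_succ_eq, Finset.mul_sum]
    refine Finset.sum_le_sum fun x hx => ?_
    rw [Finset.mul_sum]
    exact Finset.sum_le_sum fun ρ _ => hstep x hx ρ
  -- Step 3: the math layer
  have hcount := GLPred.inverter_count (X := ↥(S n)) (R := List.Vector Bool (m n)) (C := List.Vector Bool κ)
    (DfX D g S n (m n) K κ sgn) (GLEns.sec S n) hδ ?_ hk hm
  swap
  · -- the gap hypothesis
    have hgap := gap_mul_eq (D := D) g S (mm := m n) (K := K) (κ := κ) hS hg (by rw [← hκ]; rfl)
    change |PrR - PrI| * _ = _ at hgap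
    rw [← hgap]
    have hcard : (Fintype.card ↥(S n) * Fintype.card (List.Vector Bool (m n)) * Fintype.card (Fin K → BVec n) * (2 : ℝ) ^ K *
        Fintype.card (List.Vector Bool κ)) = (S n).card * 2 ^ m n * 2 ^ (K * n) * 2 ^ K * 2 ^ κ := by
      simp only [Fintype.card_coe, card_vector, Fintype.card_bool, Fintype.card_fun, Fintype.card_fin]
      simp [ZMod.card, ← pow_mul, mul_comm K n]
    rw [hcard]
    exact mul_le_mul_of_nonneg_right (hadv_eq ▸ hδle) (by positivity)
  -- Step 4: arithmetic
  unfold hidingProb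
  rw [le_div_iff₀ (by positivity)]
  refine le_trans ?_ hsum
  have htot : (Fintype.card ((↥(S n) × List.Vector Bool (m n) × GLPred.Coins n K (List.Vector Bool κ)) ×
      (Fin k → BVec n) × (Fin k → ZMod 2)) : ℝ) =
      (S n).card * 2 ^ m n * (2 ^ K * (2 * (2 ^ (K * n) * (2 ^ K * 2 ^ κ)))) * 2 ^ (k * n) * 2 ^ k := by
    rw [Fintype.card_prod, Fintype.card_prod, Fintype.card_prod, GLPred.card_Coins, Fintype.card_prod]
    simp only [Fintype.card_coe, card_vector, Fintype.card_bool, Fintype.card_fun, Fintype.card_fin, ZMod.card]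
    push_cast
    simp [← pow_mul, mul_comm K n, mul_comm k n]
    ring
  rw [htot] at hcount
  have hC2 : (2 : ℝ) ^ C = 2 * 2 ^ K * 2 * 2 ^ (K * n) * 2 ^ K * 2 ^ κ * 2 ^ (k * n) * 2 ^ k * 2 ^ W := by
    rw [hCdef]; simp only [pow_add, pow_one]; ring
  rw [hC2]
  have h2K : (0 : ℝ) < 2 ^ K := by positivity
  have h2k : (0 : ℝ) < 2 ^ k := by positivity
  calc δ / (4 * 2 ^ K * 2 ^ k) * ((S n).card * 2 ^ m n)
      = 2 ^ W / (2 * 2 ^ K * 2 * 2 ^ (K * n) * 2 ^ K * 2 ^ κ * 2 ^ (k * n) * 2 ^ k * 2 ^ W) *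
          (δ / 2 ^ K / 2 / 2 ^ k * ((S n).card * 2 ^ m n * (2 ^ K * (2 * (2 ^ (K * n) * (2 ^ K * 2 ^ κ)))) * 2 ^ (k * n) * 2 ^ k)) := by
        field_simp
        ring
    _ ≤ _ := mul_le_mul_of_nonneg_left hcount (by positivity)

end Success

end GLInv

end Literature.Computability.Cryptography
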